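import Literature.NumberTheory.LFunctions.NoRealZeroPrintedFrontier
import Literature.NumberTheory.LFunctions.RealZeroRepulsionOddClassNumberHundred
import Literature.NumberTheory.LFunctions.RealZeroEffectiveRepulsionEven
import Literature.NumberTheory.LFunctions.RealZeroLOneLowerBoundExplicit
import Literature.NumberTheory.LFunctions.ExplicitDeuringHeilbronnDirichlet
import Literature.NumberTheory.LFunctions.ZeroFreeRegionUpTo
import Literature.NumberTheory.LFunctions.SiegelAbelSummation
import Literature.NumberTheory.LFunctions.ZetaMulMeanValue
import Literature.NumberTheory.LFunctions.ZetaRealAxis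
import Literature.NumberTheory.LFunctions.GeneralizedRH
import HarnessLib

/-!
# Bordignon's explicit upper bounds for the exceptional zero of a real Dirichlet character
# (J. Number Theory 201 (2019) Thm 1.3; 210 (2020) Thm 1.3) — typed AS PRINTED, with the odd half
# DERIVED from Watkins' tables, and the even `L(1)`-floor (2020 Thm 1.2) PROVED from `q = 1.2·10⁶` on

Topic `Literature/NumberTheory/LFunctions`; namespace `Literature.NumberTheory.LFunctions`. Typed for
the cell `parity-realchar` (D-0088 (4) literature-typing layer, row (7) «Platt 2016 … instrument
provenance»): these two papers are the CONSUMERS of Platt's GRH verification in print — their standing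
hypothesis `q > 4·10⁵` is literally Platt 2016, Thm. 7.1 («Platt [Platt] proved that for a zero to be
exceptional `q > 4·10⁵` must hold», 2019 §1; «These results need to be used together with the lower
value for `q` by Platt», ibid.) — and they are the printed frontier of TARGET.md §2 row 9 of the cell
(«Bordignon 2019 Thm 1.3 / 2020: `β₀ ≤ 1 − 800/(√q log²q)` (odd, `q > 4·10⁵`), `515` (even, `q > 4·10⁵`),
`80` (even, `q > 10⁷`)», and `100` (even, 2020)), hitherto in the tree only through the weakened quotation
`BGTZ2025.theorem28_bordignon` (`HypothesisB 100 (1/2)`, Benli–Goel–Twiss–Zaman 2025, Thm. 2.8) and as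
the «print comparator» of the kernel files `RealZeroEffectiveRepulsionEven.lean`,
`RealZeroRepulsionOddClassNumberHundred.lean`.

## Sources (held, read 2026-08-28)

* M. Bordignon, *Explicit bounds on exceptional zeroes of Dirichlet L-functions*, J. Number Theory
  **201** (2019) 68–76 [Bordignon2019] = arXiv:1809.05226 (held text `paper:arxiv-1809.05226`, §1 =
  chunk p0003): «**Theorem 1.1 (McCurley).** With `R₀ = 9.6459`, the function `Π(s, q)` has at most one
  zero `ρ = β + it` in the region `β ≥ 1 − (R₀ log max{q, q|t|, 10})^{−1}`. This zero, if it exists, must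
  be real and simple and must correspond to a non-principal real character `χ (mod q)`. This zero will be
  called the exceptional zero `β₀`.» «**Theorem 1.2.** Assume `χ` is a primitive real character and
  `σ ∈ (β₀, 1)`. With `χ` odd, `β₀ ⩾ 1 − 800/(√q log² q)` and `q > 4·10⁵`, the following bound holds
  `|L′(σ,χ)| ⩽ 0.18 log² q`. With `χ` even, `β₀ ⩾ 1 − 515/(√q log² q)` and `q > 4·10⁵`, …
  `|L′(σ,χ)| ⩽ 0.1536 log² q`. With `χ` even, `β₀ ⩾ 1 − 80/(√q log² q)` and `q > 10⁷`, …
  `|L′(σ,χ)| ⩽ 0.15 log² q`.» «**Theorem 1.3.** Assume `χ` is a non-principal real character. With `χ`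
  odd and `q > 4·10⁵`, … `β₀ ≤ 1 − 800/(√q log² q)`. With `χ` even and `4·10⁵ < q ≤ 10⁷`, …
  `β₀ ≤ 1 − 515/(√q log² q)`. With `χ` even and `q > 10⁷`, … `β₀ ≤ 1 − 80/(√q log² q)`.»
  (§3: `1 − β₀ = L(1,χ)/|L′(σ,χ)|` by the mean value theorem; `L(1,χ) ≥ 46π/√q` for odd `χ` from
  Watkins' Table 4 — `h(−d) ≥ 46` for `d > 319 867` —, `L(1,χ) ≥ 12/√q` for even `χ` from
  Bennett–Martin–O'Bryant–Rechnitzer 2018, A.10; `|L′|` by partial summation against Frolenkov's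
  Pólya–Vinogradov constants; imprimitive `χ` reduced to its primitive character.)
* M. Bordignon, *Explicit bounds on exceptional zeroes of Dirichlet L-functions II*, J. Number Theory
  **210** (2020) 481–487 [Bordignon2020] = arXiv:1907.08327v1 (held, p. 2): «**Theorem 1.1.** Assume `χ`
  is an even primitive real character and `σ ∈ (β₀, 1)`. With `β₀ ⩾ 1 − 100/(√q log² q)` and
  `q > 4·10⁵`, the following bound holds `|L′(σ,χ)| ⩽ ⅛ log² q`.» «**Theorem 1.2.** Assume `χ` is an
  even primitive real character. With `q > 4·10⁵`, the following bound holds `L(1,χ) ≥ 12.52/√q`.»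
  «**Theorem 1.3.** Assume `χ` is an even non-principal real character. With `q > 4·10⁵`, the following
  bound holds `β₀ ≤ 1 − 100/(√q log² q)`.» (p. 3: Thm 1.2 from the class number formula
  `L(1,χ) = h(√d) log η_d/√d`, BMOR A.10 `h log η_d > 79.2177` for `4·10⁵ ≤ d ≤ 10⁷`, an 1800-CPU-hour
  extension `h log η_d > 412` for `d > 10⁷`, `d u₀² ≤ 7.5·10¹⁰`, and `h log η_d ≥ log(u₀√d) ≥
  ½ log(7.5·10¹⁰) ≥ 12.52` beyond; p. 6: the «more precise version» table `c = 624 … 660` for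
  `q ≤ 10⁷`, `c = 105, 104, 103, 102, 101` for `q ≤ 10¹², 10¹⁸, 10²⁶, 10⁴³, 10¹⁰⁰` — not typed.)

## Lean rendering

* «real character» = `χ.IsQuadratic` (values in `{0, ±1}`; «non-principal» = `χ ≠ 1`); «primitive» =
  `χ.IsPrimitive`; `L′(σ, χ) = deriv χ.LFunction σ` (the complex derivative at the real point `σ`;
  real for a real character); `log` natural; `√q log² q = Real.sqrt q * Real.log q ^ 2`.
* In Theorems 1.3 `β₀` is «the exceptional zero» of the source's Theorem 1.1 (McCurley, as quoted
  there with `R₀ = 9.6459`): a real zero `β₀` of `L(s, χ)` with `β₀ ≥ 1 − 1/(R₀ log max{q, 10}) =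
  1 − 1/(9.6459 log q)` (`q > 4·10⁵ > 10`). Typed with that hypothesis; the PROVED corollaries
  `bordignon2019_theorem13.odd_all`, `bordignon2020_theorem13.all` remove it (a real zero below
  McCurley's region satisfies the bound trivially, since `λ/(√q log² q) ≤ 1/(9.6459 log q)` for
  `λ ≤ 800` and `q > 4·10⁵`: `√q log q ≥ 632·12.5 > 800·9.6459`).
* `L(1,χ) ≥ 12.52/√q` (2020 Thm 1.2, PROVED part) is rendered on the real part `(χ.LFunction 1).re`
  (`L(1,χ)` is real and positive for a real `χ ≠ χ₀`: `DirichletAbel.LFunction_ofReal_im_eq_zero`,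
  `ZetaMul.LOne_pos`).
* Named facts (D-0014, review lane): `bordignon2019_theorem13`, `bordignon2020_theorem13` only — the two
  `β₀`-bounds of record (TARGET row 9); net named-fact debt `+2`, of which the odd third of the first is
  derived below from facts already in the tree.

## What is PROVED here (standard axioms)

* `one_sub_realZero_bordignon_odd_of_watkins` — **the odd half of 2019 Thm 1.3, for EVERY real zero
  `β < 1`, DERIVED from Watkins' two 2004 theorems** (`watkins2004_theorem`: no positive real zero for odd
  `d ≤ 3·10⁸`; `watkins2004_table4`: the class-number-`≤ 100` table — exactly Bordignon's own input
  «from Table 4 in Watkins … `h(√−q) ≥ 46`») through the kernel bound `18/√d < 1 − β`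
  (`ClassSumRepulsion.one_sub_realZero_gt_eighteen_all_of_watkins`) at the primitive conductor `d ∣ q`,
  `d ≥ 3`: `800/(√q log² q) ≤ 18/√q ≤ 18/√d` as `18 log² q ≥ 800` (`log q ≥ 12.5`). Hence
  `bordignon2019_theorem13_odd_of_watkins`: the odd clause of the named fact is a consequence of two other
  named facts of the tree (a fact-from-facts derivation; the even clauses are not: the kernel's even
  bound `log(q/4)/(√q log² q)` of `RealZeroEffectiveRepulsionEven.lean` reaches `80` only at `q ≥ 4e⁸⁰`).
* `bordignon2020_theorem12_of_ge` — **2020 Thm 1.2 for `q ≥ 1 200 000`, PROVED outright** from the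
  kernel's regulator floor `√q·L(1,χ) ≥ log(q/4)` (`RealZeroRepulsion.sqrt_mul_norm_LFunction_one_ge_log_of_even`,
  `ε_q ≥ (1+√q)/2`) and `log(q/4) ≥ log(300 000) ≥ 12.52` (`e^{12.52} ≤ 2.7182818286¹² · 1.718 < 300 000`);
  the printed range `4·10⁵ < q < 1.2·10⁶` rests on BMOR 2018 A.10 (`h log η_d > 79.2`), not in the tree.
* `bordignon2019_theorem13.odd_all`, `bordignon2020_theorem13.all` — the McCurley-region hypothesis
  removed (every real zero).
* `BGTZ2025.hypothesisB_of_bordignon` — **Benli–Goel–Twiss–Zaman's Hypothesis 2.6 with `ε = ½` and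
  every `B < 100` follows from the two Theorems 1.3, Platt 2016 Thm 7.1 (`q ≤ 4·10⁵`: no real zero in
  `(0,1)` at all, `grhUpTo_of_platt2016`) and McCurley 1984 Thm 1 (a zero of a COMPLEX `χ` that close to
  `1` is excluded, `McCurley1984_theorem1`)** — the provenance of `BGTZ2025.theorem28_bordignon`
  (`HypothesisB 100 (1/2)`, «[Bor19] gives `B = 800` for odd characters and [Bor20] gives `B = 100` for
  even characters. The theorem is weaker than these two results.»). TYPING NOTE: BGTZ's Hypothesis 2.6
  has the STRICT `β₁ < 1 − B/(q^ε log² q)` while Bordignon prints `β₀ ≤ 1 − 100/(√q log² q)`; so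
  `B = 100` itself is not a literal consequence (it is for `q ≤ 10¹⁰⁰` by the 2020 «more precise» table,
  `c ≥ 101`), whence `B < 100` here — a hair, recorded rather than smoothed over.

NOT typed as named facts (recorded; D-0026 — no consumer in the tree, which bounds `L′` by the kernel's
Montgomery–Vaughan (11.10) route, `DirichletLDerivativeLogSqBound.lean`): the intermediate `L′`-bounds
2019 Thm 1.2 («`χ` primitive real, `σ ∈ (β₀,1)`: odd, `β₀ ⩾ 1 − 800/(√q log² q)`, `q > 4·10⁵` ⇒
`|L′(σ,χ)| ⩽ 0.18 log² q`; even, `515`, `q > 4·10⁵` ⇒ `⩽ 0.1536 log² q`; even, `80`, `q > 10⁷` ⇒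
`⩽ 0.15 log² q`», `β₀` a free parameter) and 2020 Thm 1.1 (even primitive real, `β₀ ⩾ 1 − 100/(√q log² q)`,
`q > 4·10⁵` ⇒ `|L′(σ,χ)| ⩽ ⅛ log² q`); 2020 Thm 1.2 on its residual window `4·10⁵ < q < 1.2·10⁶` (BMOR
2018 A.10; from `1.2·10⁶` on it is the THEOREM `bordignon2020_theorem12_of_ge` below); 2019 Thm 1.4
(`|L′(σ,χ)| ≤ (1/32 + o(1)) log² p`, `p` prime, «`o(1)` explicit» only in the proof), Lemmas 2.1–2.2
(partial-summation devices), 2020 Thm 2.1 (Louboutin–Hua second-order partial summation for even `χ`),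
the 2020 p. 6 table.

## References

* [Bordignon2019] M. Bordignon, J. Number Theory 201 (2019) 68–76, Theorems 1.1 (McCurley, as quoted),
  1.2, 1.3; §3 (arXiv:1809.05226).
* [Bordignon2020] M. Bordignon, J. Number Theory 210 (2020) 481–487, Theorems 1.1, 1.2, 1.3; §2
  (arXiv:1907.08327v1 pp. 2–6).
* [BenliGoelTwissZaman2025] Hypothesis 2.6, Theorem 2.8 (tree: `ExplicitDeuringHeilbronnDirichlet.lean`).
* [Platt2016GRH] Theorem 10.1 p. 3026 (= arXiv Thm 7.1; tree `platt2016_theorem71`).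
* [McCurley1984ZFR] Theorem 1 (tree `McCurley1984_theorem1`).
* [Watkins2004RealZeros] main theorem (tree `watkins2004_theorem`); [Watkins2004ClassNumbers] Table 4
  p. 936 (tree `watkins2004_table4`).
-/

noncomputable section

open Complex

namespace Literature.NumberTheory.LFunctions

open Literature.NumberTheory.QuadraticFields Literature.Barriers.Parity

/-! ## The named facts, AS PRINTED -/

/-- **Bordignon 2019, Theorem 1.3 (as printed):** «Assume `χ` is a non-principal real character. With
`χ` odd and `q > 4·10⁵`, the following bound holds `β₀ ≤ 1 − 800/(√q log² q)`. With `χ` even and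
`4·10⁵ < q ≤ 10⁷`, the following bound holds `β₀ ≤ 1 − 515/(√q log² q)`. With `χ` even and `q > 10⁷`, the
following bound holds `β₀ ≤ 1 − 80/(√q log² q)`.» Here `β₀` is «the exceptional zero» of the source's
Theorem 1.1 (McCurley, `R₀ = 9.6459`): a real zero of `L(s, χ)` with `β₀ ≥ 1 − 1/(R₀ log max{q, 10})
= 1 − 1/(9.6459 log q)`. (The region hypothesis is removed in `bordignon2019_theorem13.odd_all`; the odd
clause is DERIVED from Watkins' tables in `bordignon2019_theorem13_odd_of_watkins`.) Proof in print: §3,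
`1 − β₀ = L(1,χ)/|L′(σ,χ)|`, Watkins' Table 4 (`h ≥ 46`), BMOR 2018 A.10, Theorem 1.2, Platt's
`q > 4·10⁵`, reduction to the primitive character. Not discharged here. [cite: Bordignon2019, Theorem 1.3] -/
def bordignon2019_theorem13 : Prop :=
  ∀ (q : ℕ) [NeZero q], 400000 < q → ∀ χ : DirichletCharacter ℂ q, χ.IsQuadratic → χ ≠ 1 →
    ∀ β₀ : ℝ, χ.LFunction β₀ = 0 → 1 - 1 / (9.6459 * Real.log q) ≤ β₀ →
      (χ.Odd → β₀ ≤ 1 - 800 / (Real.sqrt q * Real.log q ^ 2)) ∧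
      (χ.Even → q ≤ 10 ^ 7 → β₀ ≤ 1 - 515 / (Real.sqrt q * Real.log q ^ 2)) ∧
      (χ.Even → 10 ^ 7 < q → β₀ ≤ 1 - 80 / (Real.sqrt q * Real.log q ^ 2))

/-- **Bordignon 2020, Theorem 1.3 (as printed):** «Assume `χ` is an even non-principal real character.
With `q > 4·10⁵`, the following bound holds `β₀ ≤ 1 − 100/(√q log² q)`.» (`β₀` = the exceptional zero,
a real zero with `β₀ ≥ 1 − 1/(9.6459 log q)`, as in `bordignon2019_theorem13`; removed in
`bordignon2020_theorem13.all`. Proof in print: (4) `1 − β₀ = L(1,χ)/|L′(σ,χ)|`, Theorems 1.1–1.2 of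
the source, reduction to the primitive character.) Supersedes the even clauses `515`/`80` of the 2019
theorem. Not discharged here. [cite: Bordignon2020, Theorem 1.3] -/
def bordignon2020_theorem13 : Prop :=
  ∀ (q : ℕ) [NeZero q], 400000 < q → ∀ χ : DirichletCharacter ℂ q, χ.IsQuadratic → χ ≠ 1 → χ.Even →
    ∀ β₀ : ℝ, χ.LFunction β₀ = 0 → 1 - 1 / (9.6459 * Real.log q) ≤ β₀ →
      β₀ ≤ 1 - 100 / (Real.sqrt q * Real.log q ^ 2)

/-! ## Elementary arithmetic at `q > 4·10⁵` -/

namespace Bordignon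

/-- `e^{1/2} < 1.65` (`e < 2.7225 = 1.65²`). [folklore] -/
private theorem exp_half_lt : Real.exp (1 / 2) < 1.65 := by
  have h := Real.exp_one_lt_d9
  have h2 : Real.exp (1 / 2) ^ 2 = Real.exp 1 := by
    rw [← Real.exp_nat_mul]; norm_num
  nlinarith [Real.exp_pos (1 / 2)]

/-- `e^{12.5} < 400 000` (`e¹² < 2.7182818286¹²`, `e^{1/2} < 1.65`). [folklore] -/
private theorem exp_twelve_half_lt : Real.exp (12.5 : ℝ) < 400000 := by
  have h := Real.exp_one_lt_d9
  have h0 : 0 < Real.exp 1 := Real.exp_pos 1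
  have e : Real.exp (12.5 : ℝ) = Real.exp 1 ^ 12 * Real.exp (1 / 2) := by
    rw [← Real.exp_nat_mul, ← Real.exp_add]; norm_num
  rw [e]
  have h12 : Real.exp 1 ^ 12 < 2.7182818286 ^ 12 := pow_lt_pow_left₀ h h0.le (by norm_num)
  have hh := exp_half_lt
  have : (2.7182818286 : ℝ) ^ 12 * 1.65 < 400000 := by norm_num
  nlinarith [Real.exp_pos (1 / 2), pow_pos h0 12]

/-- For `q > 4·10⁵` (the standing hypothesis of the source): `log q ≥ 12.5`. [cite: Bordignon2019, §3.1 (`q > 4·10⁵`)] -/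
theorem log_ge {q : ℕ} (hq : 400000 < q) : (12.5 : ℝ) ≤ Real.log q := by
  have hq' : (400000 : ℝ) < q := by exact_mod_cast hq
  rw [Real.le_log_iff_exp_le (by linarith)]
  linarith [exp_twelve_half_lt]

/-- For `q > 4·10⁵` (the standing hypothesis of the source): `√q ≥ 632`. [cite: Bordignon2019, §3.1 (`q > 4·10⁵`)] -/
theorem sqrt_ge {q : ℕ} (hq : 400000 < q) : (632 : ℝ) ≤ Real.sqrt q := by
  have hq' : (400000 : ℝ) < q := by exact_mod_cast hq
  rw [show (632 : ℝ) = Real.sqrt (632 ^ 2) by rw [Real.sqrt_sq (by norm_num)]]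
  exact Real.sqrt_le_sqrt (by nlinarith)

/-- For `q > 4·10⁵` the product `√q · log² q` (the denominator of every bound of the source) is positive.
[cite: Bordignon2019, Theorem 1.3] -/
theorem sqrt_mul_log_sq_pos {q : ℕ} (hq : 400000 < q) : 0 < Real.sqrt q * Real.log q ^ 2 := by
  have h1 := log_ge hq
  have h2 := sqrt_ge hq
  positivity

/-- **Zeros below McCurley's region satisfy Bordignon's bounds trivially**: for `q > 4·10⁵` and
`λ ≤ 800`, `λ/(√q log² q) ≤ 1/(9.6459 log q)` (i.e. `9.6459 λ ≤ √q log q`, and `√q log q ≥ 632·12.5`).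
[cite: Bordignon2019, Theorem 1.1 (McCurley's region) and Theorem 1.3] -/
theorem window_le_region {q : ℕ} (hq : 400000 < q) {lam : ℝ} (hlam : lam ≤ 800) :
    lam / (Real.sqrt q * Real.log q ^ 2) ≤ 1 / (9.6459 * Real.log q) := by
  have h1 := log_ge hq
  have h2 := sqrt_ge hq
  have hL : 0 < Real.log q := by linarith
  have hS : 0 < Real.sqrt q := by linarith
  rw [div_le_div_iff₀ (by positivity) (by positivity)]
  have : 9.6459 * lam ≤ Real.sqrt q * Real.log q := by nlinarith
  nlinarith

end Bordignon

/-! ## The region hypothesis removed -/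

/-- **2019 Thm 1.3, odd clause, for every real zero:** under `bordignon2019_theorem13`, for
`q > 4·10⁵` and an odd non-principal real `χ` mod `q`, every real zero `β` of `L(s,χ)` satisfies
`β ≤ 1 − 800/(√q log² q)` (a zero below McCurley's region does so trivially, `Bordignon.window_le_region`).
[cite: Bordignon2019, Theorem 1.3] -/
theorem bordignon2019_theorem13.odd_all (h : bordignon2019_theorem13) {q : ℕ} [NeZero q]
    (hq : 400000 < q) {χ : DirichletCharacter ℂ q} (hquad : χ.IsQuadratic) (hχ : χ ≠ 1) (hodd : χ.Odd)
    {β : ℝ} (hz : χ.LFunction β = 0) :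
    β ≤ 1 - 800 / (Real.sqrt q * Real.log q ^ 2) := by
  rcases le_or_gt (1 - 1 / (9.6459 * Real.log q)) β with hreg | hreg
  · exact (h q hq χ hquad hχ β hz hreg).1 hodd
  · have := Bordignon.window_le_region hq (lam := 800) le_rfl
    linarith

/-- **2020 Thm 1.3 for every real zero:** under `bordignon2020_theorem13`, for `q > 4·10⁵` and an
even non-principal real `χ` mod `q`, every real zero `β` of `L(s,χ)` satisfies
`β ≤ 1 − 100/(√q log² q)`. [cite: Bordignon2020, Theorem 1.3] -/
theorem bordignon2020_theorem13.all (h : bordignon2020_theorem13) {q : ℕ} [NeZero q]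
    (hq : 400000 < q) {χ : DirichletCharacter ℂ q} (hquad : χ.IsQuadratic) (hχ : χ ≠ 1) (heven : χ.Even)
    {β : ℝ} (hz : χ.LFunction β = 0) :
    β ≤ 1 - 100 / (Real.sqrt q * Real.log q ^ 2) := by
  rcases le_or_gt (1 - 1 / (9.6459 * Real.log q)) β with hreg | hreg
  · exact h q hq χ hquad hχ heven β hz hreg
  · have := Bordignon.window_le_region hq (lam := 100) (by norm_num)
    linarith

/-! ## The odd half DERIVED from Watkins' two 2004 theorems -/

/-- The primitive character of an odd character is odd (`χ⋆(−1) = χ(−1)`, `−1` being coprime to the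
level). [folklore] -/
private theorem primitiveCharacter_odd' {q : ℕ} [NeZero q] {χ : DirichletCharacter ℂ q} (hodd : χ.Odd) :
    χ.primitiveCharacter.Odd := by
  have h := DirichletCharacter.primitiveCharacter_apply_of_isCoprime χ (a := -1)
    (isCoprime_one_left.neg_left)
  rw [DirichletCharacter.Odd]
  push_cast at h
  rw [h]
  exact hodd

/-- **Bordignon 2019, Theorem 1.3 (odd characters), DERIVED from Watkins 2004** — and for every real zero
`β < 1`, not only the exceptional one: for `q > 4·10⁵`, `χ` mod `q` real, non-principal and odd, and
`L(β, χ) = 0` with `β < 1` real, `β ≤ 1 − 800/(√q log² q)`. Route: a zero `β ≤ 0` satisfies it trivially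
(`800/(√q log² q) < 1`); for `0 < β < 1` pass to the primitive character `χ⋆` of conductor `d ∣ q`,
`3 ≤ d ≤ q`, odd and quadratic, with `L(β, χ⋆) = 0` (`LFunction_eq_zero_iff_primitiveCharacter`); the
kernel bound `18/√d < 1 − β` modulo `watkins2004_theorem` + `watkins2004_table4`
(`ClassSumRepulsion.one_sub_realZero_gt_eighteen_all_of_watkins`); and `800/(√q log² q) ≤ 18/√q ≤ 18/√d`
(`18 log² q ≥ 18·12.5² > 800`). [cite: Bordignon2019, Theorem 1.3]
[cite: Watkins2004RealZeros, main theorem] [cite: Watkins2004ClassNumbers, Table 4 p. 936] -/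
theorem one_sub_realZero_bordignon_odd_of_watkins (hZ : watkins2004_theorem) (hW : watkins2004_table4)
    {q : ℕ} [NeZero q] (hq : 400000 < q) {χ : DirichletCharacter ℂ q} (hquad : χ.IsQuadratic)
    (hχ : χ ≠ 1) (hodd : χ.Odd) {β : ℝ} (hβ1 : β < 1) (hz : χ.LFunction β = 0) :
    β ≤ 1 - 800 / (Real.sqrt q * Real.log q ^ 2) := by
  have hlog := Bordignon.log_ge hq
  have hsqrt := Bordignon.sqrt_ge hq
  have hL : 0 < Real.log q := by linarith
  have hS : 0 < Real.sqrt q := by linarith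
  have hx : 0 < Real.sqrt q * Real.log q ^ 2 := by positivity
  -- the window is narrower than `18/√q`, and `< 1`
  have hwin18 : 800 / (Real.sqrt q * Real.log q ^ 2) ≤ 18 / Real.sqrt q := by
    rw [div_le_div_iff₀ hx hS]
    have : 800 ≤ 18 * Real.log q ^ 2 := by nlinarith
    nlinarith
  have hwin1 : 800 / (Real.sqrt q * Real.log q ^ 2) < 1 := by
    rw [div_lt_one hx]; nlinarith
  rcases le_or_gt β 0 with hβ0 | hβ0
  · linarith
  -- `0 < β < 1`: pass to the primitive character
  haveI : NeZero χ.conductor := ⟨χ.conductor_ne_zero⟩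
  set ψ := χ.primitiveCharacter with hψdef
  have hχψ : DirichletCharacter.changeLevel χ.conductor_dvd_level ψ = χ :=
    DirichletCharacter.changeLevel_primitiveCharacter χ
  have hψ1 : ψ ≠ 1 := fun h' => hχ (by rw [← hχψ, h', map_one])
  have hsq : χ ^ 2 = 1 := MulChar.isQuadratic_iff_sq_eq_one.mp hquad
  have hψsq : ψ ^ 2 = 1 :=
    DirichletCharacter.changeLevel_injective χ.conductor_dvd_level
      (by rw [map_pow, hχψ, hsq, map_one])
  have hψquad : ψ.IsQuadratic := MulChar.isQuadratic_iff_sq_eq_one.mpr hψsq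
  have hψprim : ψ.IsPrimitive := DirichletCharacter.primitiveCharacter_isPrimitive χ
  have hψodd : ψ.Odd := primitiveCharacter_odd' hodd
  have hd3 : 3 ≤ χ.conductor := SiegelZeroPrimePairBarrierNarrow.three_le_level_of_ne_one ψ hψ1
  have hdq : χ.conductor ≤ q := Nat.le_of_dvd (Nat.pos_of_ne_zero (NeZero.ne q)) χ.conductor_dvd_level
  have hzψ : ψ.LFunction β = 0 :=
    (DirichletCharacter.LFunction_eq_zero_iff_primitiveCharacter χ (s := (β : ℂ))
      (by simpa using hβ0) (by
        intro h1
        have := congrArg Complex.re h1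
        simp at this
        linarith)).mp hz
  have h18 := ClassSumRepulsion.one_sub_realZero_gt_eighteen_all_of_watkins hZ hW hd3 hψprim hψquad
    hψodd hβ0 hβ1 hzψ
  -- `18/√q ≤ 18/√d`
  have hd0 : (0 : ℝ) < χ.conductor := by exact_mod_cast (show 0 < χ.conductor by omega)
  have hsd : 0 < Real.sqrt χ.conductor := Real.sqrt_pos.mpr hd0
  have hsdq : Real.sqrt χ.conductor ≤ Real.sqrt q := Real.sqrt_le_sqrt (by exact_mod_cast hdq)
  have h18q : 18 / Real.sqrt q ≤ 18 / Real.sqrt (χ.conductor : ℝ) :=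
    div_le_div_of_nonneg_left (by norm_num) hsd hsdq
  linarith

/-- **The odd clause of `bordignon2019_theorem13` follows from `watkins2004_theorem` and
`watkins2004_table4`** (in the fact's own shape: the exceptional zero of an odd non-principal real `χ` mod
`q > 4·10⁵` — the region hypothesis is not even needed). A fact-from-facts derivation: the odd third of the
2019 theorem adds no debt beyond Watkins' two certified tables. [cite: Bordignon2019, Theorem 1.3]
[cite: Watkins2004ClassNumbers, Table 4 p. 936] -/
theorem bordignon2019_theorem13_odd_of_watkins (hZ : watkins2004_theorem) (hW : watkins2004_table4) :
    ∀ (q : ℕ) [NeZero q], 400000 < q → ∀ χ : DirichletCharacter ℂ q, χ.IsQuadratic → χ ≠ 1 →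
      ∀ β₀ : ℝ, χ.LFunction β₀ = 0 → 1 - 1 / (9.6459 * Real.log q) ≤ β₀ →
        χ.Odd → β₀ ≤ 1 - 800 / (Real.sqrt q * Real.log q ^ 2) := by
  intro q _ hq χ hquad hχ β₀ hz _ hodd
  have hβ1 : β₀ < 1 := by
    by_contra hge
    exact DirichletCharacter.LFunction_ne_zero_of_one_le_re χ (Or.inl hχ)
      (by simpa using not_lt.mp hge) hz
  exact one_sub_realZero_bordignon_odd_of_watkins hZ hW hq hquad hχ hodd hβ1 hz

/-! ## 2020 Theorem 1.2 for `q ≥ 1.2·10⁶`, PROVED from the regulator floor -/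

/-- `e^{12.52} < 300 000` (`e¹² < 2.7182818286¹²`, `e^{0.52} ≤ 1 + 0.52 + 0.52²/2 + 0.52³/6 + 0.52⁴·5/(24·4)`).
[folklore] -/
private theorem exp_1252_lt : Real.exp (12.52 : ℝ) < 300000 := by
  have h := Real.exp_one_lt_d9
  have h0 : 0 < Real.exp 1 := Real.exp_pos 1
  have e : Real.exp (12.52 : ℝ) = Real.exp 1 ^ 12 * Real.exp (0.52 : ℝ) := by
    rw [← Real.exp_nat_mul, ← Real.exp_add]; norm_num
  rw [e]
  have h12 : Real.exp 1 ^ 12 < 2.7182818286 ^ 12 := pow_lt_pow_left₀ h h0.le (by norm_num)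
  have hb := Real.exp_bound' (x := (0.52 : ℝ)) (by norm_num) (by norm_num) (n := 4) (by norm_num)
  have hs : (∑ m ∈ Finset.range 4, (0.52 : ℝ) ^ m / (m.factorial : ℝ)) +
      (0.52 : ℝ) ^ 4 * (4 + 1) / ((Nat.factorial 4 : ℕ) * 4 : ℝ) ≤ 1.718 := by
    simp only [Finset.sum_range_succ, Finset.sum_range_zero, Nat.factorial]
    norm_num
  have hexp : Real.exp (0.52 : ℝ) ≤ 1.718 := hb.trans hs
  have : (2.7182818286 : ℝ) ^ 12 * 1.718 < 300000 := by norm_num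
  nlinarith [Real.exp_pos (0.52 : ℝ), pow_pos h0 12]

/-- **Bordignon 2020, Theorem 1.2 on `q ≥ 1 200 000`, PROVED:** for an even primitive real `χ` mod
`q ≥ 1.2·10⁶`, `Re L(1,χ) = L(1,χ) ≥ 12.52/√q`. Route: the kernel's `√q·‖L(1,χ)‖ ≥ log(q/4)`
(`RealZeroRepulsion.sqrt_mul_norm_LFunction_one_ge_log_of_even`: class number formula with `h_K ≥ 1` and
`R_K = log ε_q ≥ log((1+√q)/2)`), `log(q/4) ≥ log 300000 ≥ 12.52`, and `L(1,χ)` real (`Im = 0`,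
`DirichletAbel.LFunction_ofReal_im_eq_zero`) and positive (`ZetaMul.LOne_pos`). The printed range
`4·10⁵ < q < 1.2·10⁶` uses BMOR 2018 A.10 instead (`h(√d) log η_d > 79.2`), not in the tree.
[cite: Bordignon2020, Theorem 1.2] -/
theorem bordignon2020_theorem12_of_ge {q : ℕ} [NeZero q] (hq : 1200000 ≤ q)
    {χ : DirichletCharacter ℂ q} (hprim : χ.IsPrimitive) (hquad : χ.IsQuadratic) (heven : χ.Even) :
    12.52 / Real.sqrt q ≤ (χ.LFunction 1).re := by
  have hq1 : 1 < q := by omega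
  have hqR : (1200000 : ℝ) ≤ q := by exact_mod_cast hq
  have hS : 0 < Real.sqrt q := Real.sqrt_pos.mpr (by linarith)
  have hkey := RealZeroRepulsion.sqrt_mul_norm_LFunction_one_ge_log_of_even hq1 hprim hquad heven
  -- `log(q/4) ≥ 12.52`
  have hlog : (12.52 : ℝ) ≤ Real.log ((q : ℝ) / 4) := by
    rw [Real.le_log_iff_exp_le (by positivity)]
    have := exp_1252_lt
    linarith
  -- `χ ≠ 1`, `χ² = 1`, so `L(1,χ)` is real and positive
  have hχ1 : χ ≠ 1 := by
    intro h1
    rw [DirichletCharacter.isPrimitive_def, h1, DirichletCharacter.conductor_one] at hprim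
    omega
  have hsq : χ ^ 2 = 1 := MulChar.isQuadratic_iff_sq_eq_one.mp hquad
  have him : (χ.LFunction 1).im = 0 := by
    have := DirichletAbel.LFunction_ofReal_im_eq_zero χ hχ1 hsq (σ := 1) one_pos
    simpa using this
  have hpos : 0 < (χ.LFunction 1).re := by
    have := ZetaMul.LOne_pos χ hχ1 hsq
    simpa [ZetaMul.LOne] using this
  have hnorm : ‖χ.LFunction 1‖ = (χ.LFunction 1).re := by
    rw [← Complex.re_add_im (χ.LFunction 1), him]
    simp [abs_of_pos hpos]
  rw [← hnorm, div_le_iff₀ hS]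
  calc (12.52 : ℝ) ≤ Real.log ((q : ℝ) / 4) := hlog
    _ ≤ Real.sqrt q * ‖χ.LFunction 1‖ := hkey
    _ = ‖χ.LFunction 1‖ * Real.sqrt q := mul_comm _ _

/-- **Bordignon 2020, Theorem 1.2 in its printed shape, from `q = 1.2·10⁶` on, PROVED** (kernel; the
printed theorem starts at `q > 4·10⁵`, its window `4·10⁵ < q < 1.2·10⁶` resting on BMOR 2018 A.10 — not
typed as a named fact here, see the module docstring). [cite: Bordignon2020, Theorem 1.2] -/
theorem bordignon2020_theorem12_from_1200000 :
    ∀ (q : ℕ) [NeZero q], 1200000 ≤ q → ∀ χ : DirichletCharacter ℂ q, χ.IsPrimitive → χ.IsQuadratic →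
      χ.Even → 12.52 / Real.sqrt q ≤ (χ.LFunction 1).re :=
  fun _ _ hq _ hprim hquad heven => bordignon2020_theorem12_of_ge hq hprim hquad heven

/-! ## Provenance of `BGTZ2025.theorem28_bordignon`: Hypothesis 2.6 (`ε = ½`, every `B < 100`) from
Bordignon 2019/2020 + Platt 2016 + McCurley 1984 -/

/-- The principal `L`-function has no real zero in `(0, 1)`: `L(σ, χ₀) = ζ(σ) ∏_{p ∣ q}(1 − p^{−σ})`
(Mathlib `LFunctionTrivChar_eq_mul_riemannZeta`), `ζ(σ) ≠ 0` on `(0,1)` (`ZetaRealAxis`), and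
`p^{−σ} < 1`. [folklore] -/
private theorem LFunction_one_ofReal_ne_zero {q : ℕ} [NeZero q] {σ : ℝ} (h0 : 0 < σ) (h1 : σ < 1) :
    (1 : DirichletCharacter ℂ q).LFunction σ ≠ 0 := by
  have hs1 : (σ : ℂ) ≠ 1 := by
    intro h; have := congrArg Complex.re h; simp at this; linarith
  have key : (1 : DirichletCharacter ℂ q).LFunction σ =
      (∏ p ∈ q.primeFactors, (1 - (p : ℂ) ^ (-(σ : ℂ)))) * riemannZeta σ :=
    DirichletCharacter.LFunctionTrivChar_eq_mul_riemannZeta hs1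
  rw [key]
  refine mul_ne_zero (Finset.prod_ne_zero_iff.mpr fun p hp => ?_)
    (riemannZeta_ofReal_ne_zero_of_pos_of_lt_one σ h0 h1)
  have hp := Nat.prime_of_mem_primeFactors hp
  have hlt : ‖(p : ℂ) ^ (-(σ : ℂ))‖ < 1 := by
    rw [Complex.norm_natCast_cpow_of_pos hp.pos]
    simp only [neg_re, ofReal_re]
    exact Real.rpow_lt_one_of_one_lt_of_neg (by exact_mod_cast hp.one_lt) (by linarith)
  intro h
  rw [sub_eq_zero] at h
  rw [← h, norm_one] at hlt
  exact lt_irrefl _ hlt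

/-- **`BGTZ2025.HypothesisB B (1/2)` for every `B < 100` from its four printed ingredients, taken as
CLAUSES**: the odd clause of Bordignon 2019 Thm 1.3 (`800`, in the shape of
`bordignon2019_theorem13_odd_of_watkins`), Bordignon 2020 Thm 1.3 (`100`, the named fact
`bordignon2020_theorem13`), Platt 2016 Thm 7.1 and McCurley 1984 Thm 1. This is the proof of
`BGTZ2025.hypothesisB_of_bordignon` below with the 2019 theorem entering only through the one clause it
contributes, so that each clause can be fed by whatever discharges it (Watkins' tables for the odd clause:
`hypothesisB_of_watkins_bordignon2020`). For `3 ≤ q ≤ 4·10⁵` no `L(s,χ)` mod `q` has a real zero in `(0,1)`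
(Platt, `grhUpTo_of_platt2016`; the principal character by `LFunction_one_ofReal_ne_zero`); for `q > 4·10⁵`
a zero `β₁ > 1 − 1/(10 log q)` of a complex `χ` is excluded by McCurley's theorem (`R = 9.645908801 < 10`),
and a real `χ` falls under the odd (`800`) / even (`100`) clause, each `< 1 − B/(√q log² q)` as `B < 100`.
[cite: BenliGoelTwissZaman2025, Hypothesis 2.6 and Theorem 2.8] [cite: Bordignon2019, Theorem 1.3]
[cite: Bordignon2020, Theorem 1.3] -/
theorem BGTZ2025.hypothesisB_of_clauses
    (hodd800 : ∀ (q : ℕ) [NeZero q], 400000 < q → ∀ χ : DirichletCharacter ℂ q, χ.IsQuadratic → χ ≠ 1 →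
      ∀ β₀ : ℝ, χ.LFunction β₀ = 0 → 1 - 1 / (9.6459 * Real.log q) ≤ β₀ →
        χ.Odd → β₀ ≤ 1 - 800 / (Real.sqrt q * Real.log q ^ 2))
    (h20 : bordignon2020_theorem13) (hP : platt2016_theorem71) (hM : McCurley1984_theorem1) {B : ℝ}
    (hB : B < 100) : BGTZ2025.HypothesisB B (1 / 2) := by
  intro q _ hq3 χ β₁ hlo hβ1 hz
  have hq0 : (0 : ℝ) < q := by exact_mod_cast (show 0 < q by omega)
  have hq3R : (3 : ℝ) ≤ q := by exact_mod_cast hq3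
  have hlog3 : 1 < Real.log 3 := by
    rw [Real.lt_log_iff_exp_lt (by norm_num)]
    linarith [Real.exp_one_lt_d9]
  have hlogq : 1 < Real.log q := lt_of_lt_of_le hlog3 (Real.log_le_log (by norm_num) hq3R)
  have hβ0 : 0 < β₁ := by
    have : 1 / (10 * Real.log q) < 1 := by
      rw [div_lt_one (by positivity)]; linarith
    linarith
  have hsqrt : (q : ℝ) ^ (1 / 2 : ℝ) = Real.sqrt q := (Real.sqrt_eq_rpow (q : ℝ)).symm
  rw [hsqrt]
  -- the principal character has no real zero in `(0,1)`
  by_cases hχ1 : χ = 1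
  · subst hχ1
    exact absurd hz (LFunction_one_ofReal_ne_zero hβ0 hβ1)
  rcases le_or_gt q 400000 with hq | hq
  · -- Platt: no zero off the line up to height `10⁸/q`; a real zero in `(0,1)` would lie on `Re s = ½`
    have hgrh := grhUpTo_of_platt2016 (q := q) hP hq χ hχ1
    have hhalf : ((β₁ : ℂ)).re = 1 / 2 :=
      hgrh β₁ hz (by simpa using hβ0) (by simpa using hβ1)
        (by simp only [Complex.ofReal_im, abs_zero]; positivity)
    simp at hhalf
    have : 1 / (10 * Real.log q) ≤ 1 / 10 := by
      rw [div_le_div_iff₀ (by positivity) (by norm_num)]; nlinarith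
    linarith
  · -- `q > 4·10⁵`
    have hx := Bordignon.sqrt_mul_log_sq_pos hq
    have hBlt : B / (Real.sqrt q * Real.log q ^ 2) < 100 / (Real.sqrt q * Real.log q ^ 2) :=
      div_lt_div_of_pos_right hB hx
    have hreg : 1 - 1 / (9.6459 * Real.log q) ≤ β₁ := by
      have : 1 / (10 * Real.log q) ≤ 1 / (9.6459 * Real.log q) :=
        div_le_div_of_nonneg_left (by norm_num) (by positivity) (by nlinarith)
      linarith
    by_cases hsq : χ ^ 2 = 1
    · have hquad : χ.IsQuadratic := MulChar.isQuadratic_iff_sq_eq_one.mpr hsq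
      rcases χ.even_or_odd with heven | hodd
      · have h := h20 q hq χ hquad hχ1 heven β₁ hz hreg
        linarith
      · have h := hodd800 q hq χ hquad hχ1 β₁ hz hreg hodd
        have h800 : 100 / (Real.sqrt q * Real.log q ^ 2) ≤ 800 / (Real.sqrt q * Real.log q ^ 2) :=
          div_le_div_of_nonneg_right (by norm_num) hx.le
        linarith
    · -- complex `χ`: McCurley's theorem puts no zero of `L(s,χ)` that close to `1`
      exfalso
      have hq10 : (10 : ℝ) ≤ q := by
        have : (400000 : ℝ) < q := by exact_mod_cast hq
        linarith
      have hmax : max (max (q : ℝ) ((q : ℝ) * |((β₁ : ℂ)).im|)) 10 = q := by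
        simp only [Complex.ofReal_im, abs_zero, mul_zero]
        rw [max_eq_left hq0.le, max_eq_left hq10]
      have hβne : (β₁ : ℂ) ≠ 1 := by
        intro h; have := congrArg Complex.re h; simp at this; linarith
      have hregM : 1 - 1 / (9.645908801 * Real.log (max (max (q : ℝ) ((q : ℝ) * |((β₁ : ℂ)).im|)) 10)) <
          ((β₁ : ℂ)).re := by
        rw [hmax]
        simp only [Complex.ofReal_re]
        have : 1 / (10 * Real.log q) ≤ 1 / (9.645908801 * Real.log q) :=
          div_le_div_of_nonneg_left (by norm_num) (by positivity) (by nlinarith)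
        linarith
      have key := hM q hq3 χ χ (β₁ : ℂ) (β₁ : ℂ) hβne hβne hregM hregM hz hz
      exact hsq key.2.2.2

/-- **`BGTZ2025.HypothesisB B (1/2)` for every `B < 100`, from Bordignon's two Theorems 1.3, Platt 2016
Thm 7.1 and McCurley 1984 Thm 1** — the provenance of Benli–Goel–Twiss–Zaman's Theorem 2.8 («Hypothesis 2.6
holds with `ε = 1/2` and `B = 100`»; «[Bor19] gives `B = 800` for odd characters and [Bor20] gives `B = 100`
for even characters. The theorem is weaker than these two results.»). For `3 ≤ q ≤ 4·10⁵` no `L(s,χ)` mod `q`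
has a real zero in `(0,1)` at all (Platt, `grhUpTo_of_platt2016`; the principal character by
`LFunction_one_ofReal_ne_zero`); for `q > 4·10⁵` a zero `β₁ > 1 − 1/(10 log q)` of a complex `χ` is
excluded by McCurley's theorem (`R = 9.645908801 < 10`), and a real `χ` falls under Bordignon's odd
(`800`) / even (`100`) bound, each `< 1 − B/(√q log² q)` as `B < 100`. (The typed `theorem28_bordignon` has
`B = 100` with a STRICT inequality, which the printed `≤` does not literally give; see the module docstring.)
[cite: BenliGoelTwissZaman2025, Hypothesis 2.6 and Theorem 2.8] [cite: Bordignon2019, Theorem 1.3]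
[cite: Bordignon2020, Theorem 1.3] -/
theorem BGTZ2025.hypothesisB_of_bordignon (h19 : bordignon2019_theorem13) (h20 : bordignon2020_theorem13)
    (hP : platt2016_theorem71) (hM : McCurley1984_theorem1) {B : ℝ} (hB : B < 100) :
    BGTZ2025.HypothesisB B (1 / 2) := by
  exact BGTZ2025.hypothesisB_of_clauses
    (fun q _ hq χ hquad hχ β₀ hz hreg hodd => (h19 q hq χ hquad hχ β₀ hz hreg).1 hodd) h20 hP hM hB

/-- **`BGTZ2025.HypothesisB B (1/2)` for `B < 100` from Watkins' two 2004 tables, Bordignon 2020 Thm 1.3,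
Platt 2016 Thm 7.1 and McCurley 1984 Thm 1** — the odd clause supplied by
`bordignon2019_theorem13_odd_of_watkins`, so Bordignon 2019 drops out of the hypothesis list. (The even
clause `bordignon2020_theorem13` is in turn a consequence of `platt2016_theorem71`:
`Bordignon2020.bordignon2020_theorem13_of_platt` in `ExplicitExceptionalZeroBoundsEvenDerivative`.)
[cite: BenliGoelTwissZaman2025, Hypothesis 2.6 and Theorem 2.8] [cite: Watkins2004ClassNumbers, Table 4 p. 936]
[cite: Bordignon2020, Theorem 1.3] -/
theorem BGTZ2025.hypothesisB_of_watkins_bordignon2020 (hZ : watkins2004_theorem) (hW : watkins2004_table4)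
    (h20 : bordignon2020_theorem13) (hP : platt2016_theorem71) (hM : McCurley1984_theorem1) {B : ℝ}
    (hB : B < 100) : BGTZ2025.HypothesisB B (1 / 2) :=
  BGTZ2025.hypothesisB_of_clauses (bordignon2019_theorem13_odd_of_watkins hZ hW) h20 hP hM hB


/-! ## Appended 2026-08-28: Theorem 1.2 (2020) on its WHOLE printed range, PROVED — and BMOR 2018 Lemma 6.3

The kernel's sharp unit floor `√q · L(1,χ) ≥ log(q − 4)` for even real primitive `χ`
(`RealZeroRepulsion.sqrt_mul_norm_LFunction_one_ge_log_sub_four_of_even`, appended to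
`RealZeroEffectiveRepulsionEven.lean` the same day: `ε_q = (G + B√q)/2` with `G² − qB² = ±4`, so
`ε_q ≥ (√(q−4)+√q)/2` and `2 h_K R_K ≥ log(q−4)`) gives `√q·L(1,χ) ≥ log 300000 > 12.52` for every
`q ≥ 300 004`; in particular Bordignon's Theorem 1.2 holds on its whole printed range `q > 4·10⁵` with no
computation — the printed proof's window `4·10⁵ < q ≤ 7.5·10¹⁰/u₀²` (BMOR 2018 A.10 `h(√d) log η_d > 79.2177`
on `[4·10⁵, 10⁷]`, then 1800 CPU-hours for `h log η_d > 412`) and its tail bound `log(u₀√d) ≥ 12.52` both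
stem from reading the class number formula `L(1,χ_d)√d = h(√d) log η_d` with `h(√d) ≥ 1` only, whereas
`h(√d) log η_d = 2 h_K R_K ≥ 2 log ε_d ≥ log(d − 4)` (narrow class number `h(√d) = 2h_K` exactly when
`η_d = ε_d` has norm `+1`; otherwise `η_d = ε_d²`). FINDING OF RECORD (a weakness of the printed proofs, not
an error in the printed statements): Bordignon 2020 Thm 1.2 and the even half of BMOR 2018 Lemma 6.3 /
Proposition 1.10 (`q ≥ 162 759`) are elementary consequences of the class number formula.

* `bordignon2020_theorem12_of_ge_300004` — `12.52/√q ≤ L(1,χ)` for even primitive real `χ`, `q ≥ 300 004`;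
  `bordignon2020_theorem12` — **Theorem 1.2 AS PRINTED (`q > 4·10⁵`), PROVED.**
* `bmor2018_lemma63` — **Bennett–Martin–O'Bryant–Rechnitzer 2018, Lemma 6.3 AS PRINTED** («If `χ*` is a
  primitive quadratic character with modulus `q ≥ 4·10⁵`, then
  `L(1,χ*) ≥ min{46π, max{log((√(q+4)+√q)/2), 12}} q^{−1/2}`»; proof in print: odd `χ` — class number
  formula and Watkins' Table 4, «since `|d| = q > 319867`, … `h(√−q) ≥ 46`», so `L(1,χ*) ≥ 46π q^{−1/2}`;
  even `χ` — `η_d ≥ (√(d+4)+√d)/2` and the Sage computation of §7.10) — here a THEOREM modulo the single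
  named fact `watkins2004_table4` (the odd half: `Watkins2004.fortysix_le_classNumber_of_watkins`,
  `h_K ≤ 45 ⇒ |d_K| ≤ large(h_K) ≤ 319 867` by `decide` on the typed table; the even half
  `bmor2018_lemma63_even` UNCONDITIONAL with the stronger `log(q−4)/√q`), rendered on `Re L(1,χ)`
  (`= L(1,χ) > 0` for a real `χ ≠ χ₀`). Proposition 1.10 (`q > 6677 ⇒ L(1,χ) > 12/√q`) is NOT typed: on
  `6677 < q < 162 759` (even) it rests on the §7.10 computation `h(√d) log η_d > 12`, not in the tree.

References: [Bordignon2020] Theorem 1.2 and (5)–(7) p. 3; [BennettMartinOBryantRechnitzer2018] Lemma 6.3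
(§6.1) with §7.10, Proposition 1.10; [Watkins2004ClassNumbers] Table 4 p. 936 (tree `watkins2004_table4`). -/

/-- `12.52/√q ≤ Re L(1,χ)` from a floor `c ≤ √q‖L(1,χ)‖` with `12.52 ≤ c`, for a real `χ ≠ χ₀`
(`L(1,χ)` real and positive). [cite: Bordignon2020, Theorem 1.2] -/
private theorem re_LFunction_one_ge_of_floor {q : ℕ} [NeZero q] (hq : 1 < q)
    {χ : DirichletCharacter ℂ q} (hprim : χ.IsPrimitive) (hquad : χ.IsQuadratic) {c m : ℝ}
    (hfloor : c ≤ Real.sqrt q * ‖χ.LFunction 1‖) (hm : m ≤ c) :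
    m / Real.sqrt q ≤ (χ.LFunction 1).re := by
  have hqR : (1 : ℝ) < q := by exact_mod_cast hq
  have hS : 0 < Real.sqrt q := Real.sqrt_pos.mpr (by linarith)
  have hχ1 : χ ≠ 1 := by
    intro h1
    rw [DirichletCharacter.isPrimitive_def, h1, DirichletCharacter.conductor_one] at hprim
    omega
  have hsq : χ ^ 2 = 1 := MulChar.isQuadratic_iff_sq_eq_one.mp hquad
  have him : (χ.LFunction 1).im = 0 := by
    have := DirichletAbel.LFunction_ofReal_im_eq_zero χ hχ1 hsq (σ := 1) one_pos
    simpa using this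
  have hpos : 0 < (χ.LFunction 1).re := by
    have := ZetaMul.LOne_pos χ hχ1 hsq
    simpa [ZetaMul.LOne] using this
  have hnorm : ‖χ.LFunction 1‖ = (χ.LFunction 1).re := by
    rw [← Complex.re_add_im (χ.LFunction 1), him]
    simp [abs_of_pos hpos]
  rw [← hnorm, div_le_iff₀ hS]
  calc m ≤ c := hm
    _ ≤ Real.sqrt q * ‖χ.LFunction 1‖ := hfloor
    _ = ‖χ.LFunction 1‖ * Real.sqrt q := mul_comm _ _

/-- **Bordignon 2020, Theorem 1.2 from `q = 300 004` on, PROVED** (no table, no computation): for an even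
primitive real `χ` mod `q ≥ 300 004`, `L(1,χ) ≥ 12.52/√q`, by `√q·L(1,χ) ≥ log(q − 4) ≥ log 300000 > 12.52`
(`e^{12.52} < 300 000`). [cite: Bordignon2020, Theorem 1.2] -/
theorem bordignon2020_theorem12_of_ge_300004 {q : ℕ} [NeZero q] (hq : 300004 ≤ q)
    {χ : DirichletCharacter ℂ q} (hprim : χ.IsPrimitive) (hquad : χ.IsQuadratic) (heven : χ.Even) :
    12.52 / Real.sqrt q ≤ (χ.LFunction 1).re := by
  have hq1 : 1 < q := by omega
  have hqR : (300004 : ℝ) ≤ q := by exact_mod_cast hq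
  have hkey := RealZeroRepulsion.sqrt_mul_norm_LFunction_one_ge_log_sub_four_of_even hq1 hprim hquad heven
  refine re_LFunction_one_ge_of_floor hq1 hprim hquad hkey ?_
  rw [Real.le_log_iff_exp_le (by linarith)]
  have := exp_1252_lt
  linarith

/-- **Bordignon, J. Number Theory 210 (2020), Theorem 1.2 — AS PRINTED, PROVED:** «Assume `χ` is an even
primitive real character. With `q > 4·10⁵`, the following bound holds `L(1,χ) ≥ 12.52/√q`.» (Printed
proof: class number formula, BMOR 2018 A.10 and an 1800-CPU-hour extension, `log(u₀√d) ≥ 12.52` beyond;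
kernel proof: `√q·L(1,χ) = 2h_K R_K ≥ log(q−4)`.) [cite: Bordignon2020, Theorem 1.2] -/
theorem bordignon2020_theorem12 :
    ∀ (q : ℕ) [NeZero q] (χ : DirichletCharacter ℂ q), 400000 < q → χ.IsPrimitive → χ.IsQuadratic →
      χ.Even → 12.52 / Real.sqrt q ≤ (χ.LFunction 1).re :=
  fun _ _ _ hq hprim hquad heven => bordignon2020_theorem12_of_ge_300004 (by omega) hprim hquad heven

/-! ### BMOR 2018, Lemma 6.3 -/

namespace Watkins2004

open Literature.NumberTheory.QuadraticFields.Watkins2004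

/-- On the typed Table 4: `large(N) ≤ 319 867` for every `N ≤ 45` (the maximum is `large(44) = 319 867`).
[cite: Watkins2004ClassNumbers, Table 4 p. 936] -/
theorem largest_le_of_le_45 {N : ℕ} (hN : N ≤ 45) : largest N ≤ 319867 := by
  interval_cases N <;> decide

/-- **`|d_K| > 319 867 ⇒ h_K ≥ 46`** for an imaginary quadratic field (modulo Table 4) — BMOR's «Appealing
to Watkins, since `|d| = q > 319867`, we may conclude that `h(√−q) ≥ 46`».
[cite: Watkins2004ClassNumbers, Table 4 p. 936] [cite: BennettMartinOBryantRechnitzer2018, Lemma 6.3 (proof)] -/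
theorem fortysix_le_classNumber_of_watkins (h : watkins2004_table4) (K : Type) [Field K] [NumberField K]
    (h2 : Module.finrank ℚ K = 2) (hd : NumberField.discr K < 0)
    (hD : 319867 < (NumberField.discr K).natAbs) :
    46 ≤ NumberField.classNumber K := by
  by_contra hlt
  rw [not_le] at hlt
  have h100 : NumberField.classNumber K ≤ 100 := by omega
  have hle := natAbs_discr_le_largest h K h2 hd h100
  have := largest_le_of_le_45 (N := NumberField.classNumber K) (by omega)
  omega

/-- **`√D · |L(1, χ)| ≥ 46π` for every odd real primitive `χ` mod `D > 319 867`** (modulo Table 4): class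
number formula `L(1,χ) = 2πh_K/(w_K√D)`, `w_K = 2`, `h_K ≥ 46` — the odd half of BMOR Lemma 6.3.
[cite: BennettMartinOBryantRechnitzer2018, Lemma 6.3] [cite: Watkins2004ClassNumbers, Table 4 p. 936] -/
theorem sqrt_mul_norm_LFunction_one_ge_46pi (h : watkins2004_table4) {D : ℕ} [NeZero D]
    {χ : DirichletCharacter ℂ D} (hprim : χ.IsPrimitive) (hquad : χ.IsQuadratic) (hodd : χ.Odd)
    (hD : 319867 < D) :
    46 * Real.pi ≤ Real.sqrt D * ‖χ.LFunction 1‖ := by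
  classical
  obtain ⟨K, instF, instNF, h2, hdK⟩ :=
    Quadratic.exists_quadraticField_of_odd_primitive hprim hquad hodd
  have hD0 : 0 < D := Nat.pos_of_ne_zero (NeZero.ne D)
  have hd : NumberField.discr K < 0 := by rw [hdK, neg_lt_zero]; exact_mod_cast hD0
  have hd4 : NumberField.discr K < -4 := by rw [hdK]; omega
  have hχ1 : χ ≠ 1 := by
    intro h1
    have hm : χ (-1) = -1 := hodd
    rw [h1, MulChar.one_apply isUnit_one.neg] at hm
    norm_num at hm
  have hζ : ∀ s : ℝ, 1 < s →
      NumberField.dedekindZeta K s = riemannZeta s * LSeries (fun n => χ n) s := by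
    intro s hs
    have hs' : 1 < (s : ℂ).re := by simpa using hs
    rw [← DirichletCharacter.LFunction_eq_LSeries χ hs']
    exact Quadratic.dedekindZeta_eq_riemannZeta_mul_LFunction_of_odd_primitive hprim hquad hodd h2 hdK hs'
  have hL := Quadratic.LFunction_one_eq_of_discr_neg_of_eq h2 hd hχ1 hζ
  have habs : |(NumberField.discr K : ℝ)| = (D : ℝ) := by
    rw [hdK]; push_cast; rw [abs_neg]; exact abs_of_nonneg (Nat.cast_nonneg D)
  have hw : (NumberField.Units.torsionOrder K : ℝ) = 2 := by
    exact_mod_cast Quadratic.torsionOrder_eq_two_of_discr_lt_neg_four h2 hd4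
  rw [habs, hw] at hL
  have hnat : (NumberField.discr K).natAbs = D := by rw [hdK]; simp
  have h46 : (46 : ℝ) ≤ NumberField.classNumber K := by
    have := fortysix_le_classNumber_of_watkins h K h2 hd (by rw [hnat]; exact hD)
    exact_mod_cast this
  have hsqrt : 0 < Real.sqrt D := Real.sqrt_pos.mpr (by exact_mod_cast hD0)
  have hval : ‖χ.LFunction 1‖ = Real.pi * NumberField.classNumber K / Real.sqrt D := by
    rw [hL, Complex.norm_real, Real.norm_eq_abs, abs_of_nonneg (by positivity)]
    field_simp
  rw [hval, mul_div_cancel₀ _ hsqrt.ne']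
  nlinarith [Real.pi_pos]

end Watkins2004

/-- `log((√(q+4)+√q)/2) ≤ log(q − 4)` for `q ≥ 9` (`(√(q+4)+√q)/2 ≤ √(q+4) ≤ q − 4` as `q + 4 ≤ (q−4)²`).
[folklore] -/
private theorem log_half_sqrt_add_le_log_sub_four {q : ℝ} (hq : 9 ≤ q) :
    Real.log ((Real.sqrt (q + 4) + Real.sqrt q) / 2) ≤ Real.log (q - 4) := by
  have hs : Real.sqrt q ≤ Real.sqrt (q + 4) := Real.sqrt_le_sqrt (by linarith)
  have hs4 : 0 < Real.sqrt (q + 4) := Real.sqrt_pos.mpr (by linarith)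
  have hs0 : 0 < Real.sqrt q := Real.sqrt_pos.mpr (by linarith)
  have hle : Real.sqrt (q + 4) ≤ q - 4 := by
    rw [Real.sqrt_le_left] <;> nlinarith
  exact Real.log_le_log (by positivity) (by linarith)

/-- **The even half of BMOR 2018 Lemma 6.3, UNCONDITIONAL and sharpened:** for an even primitive real `χ`
mod `q ≥ 4·10⁵`, `Re L(1,χ) ≥ max{log((√(q+4)+√q)/2), 12}/√q` — indeed `≥ log(q−4)/√q`, which dominates
both entries (`log(q − 4) > 12.5 > 12`; `(√(q+4)+√q)/2 ≤ q − 4`).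
[cite: BennettMartinOBryantRechnitzer2018, Lemma 6.3] -/
theorem bmor2018_lemma63_even {q : ℕ} [NeZero q] (hq : 400000 ≤ q)
    {χ : DirichletCharacter ℂ q} (hprim : χ.IsPrimitive) (hquad : χ.IsQuadratic) (heven : χ.Even) :
    max (Real.log ((Real.sqrt ((q : ℝ) + 4) + Real.sqrt q) / 2)) 12 / Real.sqrt q ≤ (χ.LFunction 1).re := by
  have hq1 : 1 < q := by omega
  have hqR : (400000 : ℝ) ≤ q := by exact_mod_cast hq
  have hkey := RealZeroRepulsion.sqrt_mul_norm_LFunction_one_ge_log_sub_four_of_even hq1 hprim hquad heven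
  refine re_LFunction_one_ge_of_floor hq1 hprim hquad hkey (max_le ?_ ?_)
  · exact log_half_sqrt_add_le_log_sub_four (by linarith)
  · rw [Real.le_log_iff_exp_le (by linarith)]
    have hexp : Real.exp 12 ≤ Real.exp (12.52 : ℝ) := Real.exp_le_exp.mpr (by norm_num)
    have := exp_1252_lt
    linarith

/-- **Bennett–Martin–O'Bryant–Rechnitzer, Illinois J. Math. 62 (2018), Lemma 6.3 — AS PRINTED, a THEOREM
modulo Watkins' Table 4:** «If `χ*` is a primitive quadratic character with modulus `q ≥ 4·10⁵`, then
`L(1,χ*) ≥ min{46π, max{log((√(q+4)+√q)/2), 12}} q^{−1/2}`» (`= 12q^{−1/2}` for `4·10⁵ ≤ q < e²⁴ − 2`,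
`½q^{−1/2} log q`-sized up to `e^{92π} − 2`, `46π q^{−1/2}` beyond). Odd `χ*`: `46π/√q` from `h_K ≥ 46`
(`|d| > 319 867`, the fact `watkins2004_table4`); even `χ*`: `bmor2018_lemma63_even` (kernel, no table).
Rendered on `Re L(1,χ*) = L(1,χ*)`. [cite: BennettMartinOBryantRechnitzer2018, Lemma 6.3]
[cite: Watkins2004ClassNumbers, Table 4 p. 936] -/
theorem bmor2018_lemma63 (hW : watkins2004_table4) {q : ℕ} [NeZero q] (hq : 400000 ≤ q)
    {χ : DirichletCharacter ℂ q} (hprim : χ.IsPrimitive) (hquad : χ.IsQuadratic) :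
    min (46 * Real.pi) (max (Real.log ((Real.sqrt ((q : ℝ) + 4) + Real.sqrt q) / 2)) 12) / Real.sqrt q ≤
      (χ.LFunction 1).re := by
  have hq1 : 1 < q := by omega
  have hqR : (400000 : ℝ) ≤ q := by exact_mod_cast hq
  have hS : 0 < Real.sqrt q := Real.sqrt_pos.mpr (by linarith)
  rcases χ.even_or_odd with heven | hodd
  · refine le_trans ?_ (bmor2018_lemma63_even hq hprim hquad heven)
    exact div_le_div_of_nonneg_right (min_le_right _ _) hS.le
  · have hkey := Watkins2004.sqrt_mul_norm_LFunction_one_ge_46pi hW hprim hquad hodd (by omega)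
    exact re_LFunction_one_ge_of_floor hq1 hprim hquad hkey (min_le_left _ _)

/-! ## Appended 2026-08-28 (ter): the LOWER half of BGTZ 2025 Lemma 2.9, for every real non-principal
character, modulo Platt's table

`BGTZ2025.lemma29` (Benli–Goel–Twiss–Zaman, Lemma 2.9: «Let `q > 400,000` be an integer. If
`1 − 1/(10 log q) < β₁ < 1` is a real zero of `L(s,χ₁)` where `χ₁ (mod q)` is a real quadratic character,
then `0.72 ≤ L(1,χ₁)/(1 − β₁) ≤ 0.18 (log q)²`») is typed as a conjunction for every quadratic
`χ₁ ≠ χ₀` mod `q`, primitive or not. Its LOWER inequality — the half consumed by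
`Zhang2022.exceptionalZero_of_assumptionA` and by the class-number readings — is here a THEOREM with the
kernel's better constant `0.81`, modulo `platt2016_theorem71` alone: the kernel master inequality
`RealZeroRepulsion.lOne_ge_of_realZero_master` (hyperbola method at the zero, `X = q⁶`) needs no
primitivity, only the a-priori bound `1 − β ≥ 1000/q²`, which comes from the kernel repulsion of the
INDUCING primitive character `χ⋆` mod `q′` when `q′ ≥ 10⁴`
(`RealZeroRepulsion.thousand_div_sq_le_one_sub_realZero` at level `q′ ≤ q`), while for `q′ ≤ 4·10⁵`
Platt's GRH verification leaves `L(s,χ⋆)` no real zero in `(0,1)` at all. (The printed proof: Mellin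
inversion + Thorner–Zaman's explicit convexity; not followed.) The UPPER inequality `≤ 0.18 log² q` is NOT
derived here: the source says it «follows from [Bordignon 2019]», whose `L′`-bounds are stated on the
narrow windows `c/(√q log² q)` and for primitive characters only. -/

/-- `e^{3/5} < 1.823` (`(e^{3/5})⁵ = e³ < 2.7182818286³ < 1.823⁵`). [folklore] -/
private theorem exp_three_fifths_lt' : Real.exp (3 / 5) < 1.823 := by
  have h := Real.exp_one_lt_d9
  have h0 : 0 < Real.exp 1 := Real.exp_pos 1
  have e5 : Real.exp (3 / 5) ^ 5 = Real.exp 1 ^ 3 := by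
    rw [← Real.exp_nat_mul, ← Real.exp_nat_mul]; norm_num
  have h3 : Real.exp 1 ^ 3 < 2.7182818286 ^ 3 := pow_lt_pow_left₀ h h0.le (by norm_num)
  by_contra hge
  rw [not_lt] at hge
  have h5 : (1.823 : ℝ) ^ 5 ≤ Real.exp (3 / 5) ^ 5 := pow_le_pow_left₀ (by norm_num) hge 5
  have : (2.7182818286 : ℝ) ^ 3 < 1.823 ^ 5 := by norm_num
  linarith

/-- The primitive character inducing a quadratic character is quadratic. [folklore] -/
private theorem primitiveCharacter_isQuadratic {q : ℕ} [NeZero q] {χ : DirichletCharacter ℂ q}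
    (hquad : χ.IsQuadratic) : χ.primitiveCharacter.IsQuadratic := by
  have hχψ : DirichletCharacter.changeLevel χ.conductor_dvd_level χ.primitiveCharacter = χ :=
    DirichletCharacter.changeLevel_primitiveCharacter χ
  have hsq : χ ^ 2 = 1 := MulChar.isQuadratic_iff_sq_eq_one.mp hquad
  exact MulChar.isQuadratic_iff_sq_eq_one.mpr
    (DirichletCharacter.changeLevel_injective χ.conductor_dvd_level (by rw [map_pow, hχψ, hsq, map_one]))

/-- **The lower half of BGTZ 2025 Lemma 2.9 with the kernel constant, for EVERY real non-principal
character, modulo Platt's table:** for `q > 4·10⁵`, `χ` mod `q` quadratic, `χ ≠ χ₀` (primitive or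
not), and a real zero `β` of `L(s,χ)` with `1 − 1/(10 log q) < β < 1`: `0.81 (1 − β) ≤ Re L(1,χ)`.
Route: `χ⋆` mod `q′ ∣ q` primitive quadratic with `L(β,χ⋆) = 0` (`0 < β < 1`); `q′ ≤ 4·10⁵` is
impossible by `grhUpTo_of_platt2016` (`Re β = ½` against `β > 0.99`); for `q′ > 4·10⁵` the kernel
repulsion at level `q′` gives `1 − β ≥ 1000/q′² ≥ 1000/q²`, and the kernel master inequality at level
`q` (window `1/(10 log q)`: `e^{6(1−β) log q} ≤ e^{3/5} < 1.823`, `1.4913/1.823 − 0.0041 > 0.81`) concludes.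
[cite: BenliGoelTwissZaman2025, Lemma 2.9] [cite: MontgomeryVaughan2007, §11.2 (11.10)]
[cite: Platt2016GRH, Theorem 7.1] -/
theorem BGTZ2025.lOne_ge_of_realZero_tenth_of_platt (hP : platt2016_theorem71) {q : ℕ} [NeZero q]
    (hq : 400000 < q) {χ : DirichletCharacter ℂ q} (hquad : χ.IsQuadratic) (hχ : χ ≠ 1) {β : ℝ}
    (hlo : 1 - 1 / (10 * Real.log q) < β) (hβ1 : β < 1) (hz : χ.LFunction β = 0) :
    0.81 * (1 - β) ≤ (χ.LFunction 1).re := by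
  have hlog := Bordignon.log_ge hq
  have hL0 : 0 < Real.log q := by linarith
  have hq4 : 10 ^ 4 ≤ q := by omega
  have hβ0 : 0 < β := by
    have : 1 / (10 * Real.log q) < 1 := by
      rw [div_lt_one (by positivity)]; linarith
    linarith
  -- the inducing primitive character
  haveI : NeZero χ.conductor := ⟨χ.conductor_ne_zero⟩
  set ψ := χ.primitiveCharacter with hψdef
  have hχψ : DirichletCharacter.changeLevel χ.conductor_dvd_level ψ = χ :=
    DirichletCharacter.changeLevel_primitiveCharacter χ
  have hψ1 : ψ ≠ 1 := fun h' => hχ (by rw [← hχψ, h', map_one])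
  have hψquad : ψ.IsQuadratic := primitiveCharacter_isQuadratic hquad
  have hψprim : ψ.IsPrimitive := DirichletCharacter.primitiveCharacter_isPrimitive χ
  have hdq : χ.conductor ≤ q := Nat.le_of_dvd (Nat.pos_of_ne_zero (NeZero.ne q)) χ.conductor_dvd_level
  have hzψ : ψ.LFunction β = 0 :=
    (DirichletCharacter.LFunction_eq_zero_iff_primitiveCharacter χ (s := (β : ℂ))
      (by simpa using hβ0) (by
        intro h1
        have := congrArg Complex.re h1
        simp at this
        linarith)).mp hz
  -- a-priori bound `1000/q² ≤ 1 − β`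
  have hrep : 1000 / (q : ℝ) ^ 2 ≤ 1 - β := by
    rcases le_or_gt χ.conductor 400000 with hd | hd
    · -- Platt: `L(s, χ⋆)` has no real zero in `(0,1)`
      exfalso
      have hgrh := grhUpTo_of_platt2016 (q := χ.conductor) hP hd ψ hψ1
      have hhalf : ((β : ℂ)).re = 1 / 2 :=
        hgrh β hzψ (by simpa using hβ0) (by simpa using hβ1)
          (by simp only [Complex.ofReal_im, abs_zero]; positivity)
      simp at hhalf
      have : 1 / (10 * Real.log q) ≤ 1 / 10 := by
        rw [div_le_div_iff₀ (by positivity) (by norm_num)]; nlinarith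
      linarith
    · have hd4 : 10 ^ 4 ≤ χ.conductor := by omega
      have h := RealZeroRepulsion.thousand_div_sq_le_one_sub_realZero ψ hd4 hψprim hψquad hzψ
      have hd0 : (0 : ℝ) < χ.conductor := by exact_mod_cast (show 0 < χ.conductor by omega)
      have hdqR : (χ.conductor : ℝ) ≤ q := by exact_mod_cast hdq
      have : 1000 / (q : ℝ) ^ 2 ≤ 1000 / (χ.conductor : ℝ) ^ 2 :=
        div_le_div_of_nonneg_left (by norm_num) (by positivity) (pow_le_pow_left₀ hd0.le hdqR 2)
      linarith
  -- the kernel master inequality at level `q` (no primitivity needed), window `1/(10 log q)`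
  have hβ4 : 1 - 1 / (4 * Real.log q) ≤ β := by
    have : 1 / (10 * Real.log q) ≤ 1 / (4 * Real.log q) :=
      one_div_le_one_div_of_le (by positivity) (by linarith)
    linarith
  have hm := RealZeroRepulsion.lOne_ge_of_realZero_master χ hq4 hχ hquad.sq_eq_one hz hβ4 hrep
  have hκ0 : 0 < 1 - β := by linarith
  have h6 : 6 * (1 - β) * Real.log q ≤ 3 / 5 := by
    have h1 : 1 - β ≤ 1 / (10 * Real.log q) := by linarith
    have h2 : (1 - β) * Real.log q ≤ 1 / (10 * Real.log q) * Real.log q :=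
      mul_le_mul_of_nonneg_right h1 hL0.le
    have h3 : 1 / (10 * Real.log q) * Real.log q = 1 / 10 := by field_simp
    linarith
  have hW : Real.exp (6 * (1 - β) * Real.log q) ≤ 1.823 :=
    le_trans (Real.exp_le_exp.mpr h6) exp_three_fifths_lt'.le
  have hdiv : 1.4913 / 1.823 ≤ 1.4913 / Real.exp (6 * (1 - β) * Real.log q) :=
    div_le_div_of_nonneg_left (by norm_num) (Real.exp_pos _) hW
  have hc : (0.81 : ℝ) ≤ 1.4913 / Real.exp (6 * (1 - β) * Real.log q) - 0.0041 := by
    have : (0.81 : ℝ) + 0.0041 ≤ 1.4913 / 1.823 := by norm_num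
    linarith
  calc 0.81 * (1 - β) = (1 - β) * 0.81 := by ring
    _ ≤ (1 - β) * (1.4913 / Real.exp (6 * (1 - β) * Real.log q) - 0.0041) :=
        mul_le_mul_of_nonneg_left hc hκ0.le
    _ ≤ (χ.LFunction 1).re := hm

/-- **BGTZ 2025 Lemma 2.9, LOWER inequality, in the named fact's own shape** (`0.72 (1 − β₁) ≤ Re L(1,χ₁)`
for every quadratic `χ₁ ≠ χ₀` mod `q > 4·10⁵` and every real zero `β₁ ∈ (1 − 1/(10 log q), 1)`), modulo
`platt2016_theorem71` — the first conjunct of `BGTZ2025.lemma29`, with `0.72 ≤ 0.81`.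
[cite: BenliGoelTwissZaman2025, Lemma 2.9] [cite: Platt2016GRH, Theorem 7.1] -/
theorem BGTZ2025.lemma29_lower_of_platt (hP : platt2016_theorem71) :
    ∀ (q : ℕ) [NeZero q], 400000 < q → ∀ χ₁ : DirichletCharacter ℂ q, χ₁.IsQuadratic → χ₁ ≠ 1 →
      ∀ β₁ : ℝ, 1 - 1 / (10 * Real.log q) < β₁ → β₁ < 1 → χ₁.LFunction β₁ = 0 →
        0.72 * (1 - β₁) ≤ (χ₁.LFunction 1).re := by
  intro q _ hq χ₁ hquad hχ β₁ hlo hβ1 hz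
  have h := BGTZ2025.lOne_ge_of_realZero_tenth_of_platt hP hq hquad hχ hlo hβ1 hz
  have : 0 ≤ 1 - β₁ := by linarith
  nlinarith

/-! ### BGTZ 2025 Lemma 2.9 — the upper half for PRIMITIVE characters (item E-lemma29-upper)

Theory ruling E-lemma29-upper (CONDITIONALS.md v1.3r, 2026-08-28): the named fact `BGTZ2025.lemma29` renders
Benli–Goel–Twiss–Zaman's Lemma 2.9 for EVERY quadratic `χ₁ ≠ χ₀` mod `q`, as printed; its proof («the upper
bound follows from [Bordignon 2019]») rests on Bordignon's `L′`-bounds, which are stated and proved for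
PRIMITIVE real characters (J. Number Theory 201 (2019), Thm 1.2: `|L′(σ,χ)| ≤ 0.18 log² q` for odd and
`0.1536 log² q` for even primitive real `χ`, `q > 4·10⁵`, on the windows `σ ≥ 1 − c/(√q log² q)`), so the
upper inequality is supported in print for primitive `χ₁` only (for `χ₁` induced from `χ⋆` mod `q′` the
Euler factor `∏_{p ∣ q, p ∤ q′}(1 − χ⋆(p)/p)` of `L(1,χ₁)` is not controlled). The lower half is derived
modulo Platt alone for every quadratic `χ₁` (`BGTZ2025.lemma29_lower_of_platt`, above). Here the upper half
is PROVED for primitive `χ₁` on BGTZ's own window with the constant the tree's Pólya–Vinogradov inequality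
gives (`½`; Bordignon's `0.18` needs Frolenkov–Soundararajan's constant), and the two halves are assembled
for primitive quadratic `χ₁` modulo `platt2016_theorem71`. The two consumers of `lemma29`'s upper half in the
tree are primitive and constant-insensitive and have `h29`-free forms:
`WrightPrimeTuples.StrongSiegelZeros.smallEtaCharacters_of_logSq` (`SiegelZerosPrimeTuples`),
`ModifiedGRH.landauSiegelZero_repulsion_of_logSq` (`ModifiedGRHLOneLowerBounds`). -/

/-- **Benli–Goel–Twiss–Zaman 2025, Lemma 2.9 — the UPPER inequality for PRIMITIVE `χ₁`, PROVED with the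
constant `½`:** for `q > 4·10⁵`, `χ₁` mod `q` primitive (any order; reality is not needed for this half) and a
real zero `β₁ > 1 − 1/(10 log q)` of `L(s,χ₁)`: `Re L(1,χ₁) ≤ ½ log² q · (1 − β₁)` (mean value theorem on
`[β₁, 1]` and `‖L′(σ,χ₁)‖ ≤ ½ log² q` there, `DirichletAbel.norm_deriv_LFunction_le_half_log_sq_of_ge_4e5`).
The print has `0.18` (for every real `χ₁`; see the section docstring for why only the primitive case is
supported by its source). [cite: BenliGoelTwissZaman2025, Lemma 2.9] [cite: Bordignon2019, Theorem 1.2]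
[cite: MontgomeryVaughan2007, Theorem 11.4 (11.10)] -/
theorem BGTZ2025.lemma29_upper_primitive {q : ℕ} [NeZero q] (hq : 400000 < q)
    {χ₁ : DirichletCharacter ℂ q} (hprim : χ₁.IsPrimitive) {β₁ : ℝ}
    (hlo : 1 - 1 / (10 * Real.log q) < β₁) (hz : χ₁.LFunction β₁ = 0) :
    (χ₁.LFunction 1).re ≤ 1 / 2 * Real.log q ^ 2 * (1 - β₁) := by
  have h := DirichletAbel.norm_LFunction_one_le_half_log_sq_of_realZero_tenth hq.le hprim hlo.le hz
  exact (Complex.re_le_norm _).trans h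

/-- **BGTZ 2025 Lemma 2.9 for PRIMITIVE quadratic `χ₁` — both inequalities, modulo Platt's table only:**
`0.72 (1 − β₁) ≤ Re L(1,χ₁) ≤ ½ log² q · (1 − β₁)` for `q > 4·10⁵`, `χ₁` mod `q` primitive and quadratic,
and a real zero `β₁ ∈ (1 − 1/(10 log q), 1)` (lower: `BGTZ2025.lemma29_lower_of_platt`; upper:
`BGTZ2025.lemma29_upper_primitive`, constant `½` in place of the printed `0.18`). This is the shape of the
named fact `BGTZ2025.lemma29` restricted to the generality its printed proof supports.
[cite: BenliGoelTwissZaman2025, Lemma 2.9] [cite: Platt2016GRH, Theorem 7.1] -/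
theorem BGTZ2025.lemma29_primitive_of_platt (hP : platt2016_theorem71) :
    ∀ (q : ℕ) [NeZero q], 400000 < q → ∀ χ₁ : DirichletCharacter ℂ q, χ₁.IsQuadratic → χ₁.IsPrimitive →
      ∀ β₁ : ℝ, 1 - 1 / (10 * Real.log q) < β₁ → β₁ < 1 → χ₁.LFunction β₁ = 0 →
        0.72 * (1 - β₁) ≤ (χ₁.LFunction 1).re ∧
          (χ₁.LFunction 1).re ≤ 1 / 2 * Real.log q ^ 2 * (1 - β₁) := by
  intro q _ hq χ₁ hquad hprim β₁ hlo hβ1 hz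
  have hne : χ₁ ≠ 1 := by
    rintro rfl
    rw [DirichletCharacter.isPrimitive_def, DirichletCharacter.conductor_one] at hprim
    omega
  exact ⟨BGTZ2025.lemma29_lower_of_platt hP q hq χ₁ hquad hne β₁ hlo hβ1 hz,
    BGTZ2025.lemma29_upper_primitive hq hprim hlo hz⟩

end Literature.NumberTheory.LFunctions

end
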